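import Literature.NumberTheory.LFunctions.BurnolZetaSystemsHardy
import HarnessLib

/-!
# The Hardy space `ℍ²(Re s > 1/2)` in the analytic picture: closure properties used in Burnol 2004b §4

LINE 1 — LABEL: RH-FREE folklore analysis (bookkeeping for the Hardy space `ℍ²` of the half-plane
`Re s > 1/2` in the ANALYTIC picture `IsHardyRight` of `BurnolZetaSystemsHardy.lean`: holomorphic on
`Re s > 1/2` with uniformly bounded `L²` norms on the vertical lines). FRAMING (cell rh-crit, D-0074):
infrastructure for the as-printed discharges of Burnol 2004b §4 (Props. 4.2, 4.3, Lemma 4.4), whose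
printed proofs argue "going back to the definition of `ℍ²` as a space of analytic functions in the right
half-plane with a uniform bound of their `L²` norms on vertical lines" (TeX l.702–706). bears_on:
B-C/B-P (LADDER-RH COLUMN 6, de Branges framework) as infrastructure only. WHAT THIS IS NOT: not a
route, not a criterion, no Paley–Wiener theorem (that is `HardyPaleyWiener.lean`); nothing here bears
on the truth of RH.

## Main results (all PROVED; no definition, no named fact)

* `IsHardyRight.congr` — `ℍ²`-membership only depends on the values on `Re s > 1/2`.
* `IsHardyRight.zero`, `.add`, `.const_mul`, `.neg`, `.sub` — `ℍ²` is a vector space.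
* `IsHardyRight.mul_of_bounded` — a multiplier `φ` holomorphic and bounded on `Re s > 1/2` preserves
  `ℍ²`; `IsHardyRight.div_id` — `F ∈ ℍ² ⇒ F(s)/s ∈ ℍ²` ("simply from `1/|s| = O(1)` on `Re(s) ≥ 1/2`",
  the first step of Lemma 4.4, TeX l.752–754).
* `IsHardyRight.of_le_off_rect'` — if `G` is holomorphic on `Re s > 1/2`, bounded on the part of a
  rectangle `[σ₁, σ₂] × [−R, R]` inside the half-plane, and `‖G‖ ≤ C‖F‖` off that rectangle, with
  `F ∈ ℍ²`, then `G ∈ ℍ²` (the "exclude a neighbourhood of `ρ`" step of Prop. 4.2, TeX l.702–706, and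
  of Prop. 4.3, TeX l.722–724; the rectangle may stick out of the half-plane — a neighbourhood of a
  zero `ρ` ON the critical line); `IsHardyRight.of_le_off_rect` — the same for a compact rectangle of
  the OPEN half-plane (`σ₁ > 1/2`), where the bound on the rectangle comes from continuity.

## References

* J.-F. Burnol, *Two complete and minimal systems associated with the zeros of the Riemann zeta
  function*, J. Théor. Nombres Bordeaux 16 (2004) 65–94 = arXiv:math/0203120v7, §4 (TeX of record
  `dbl/src/Burnol2004JTNB_arXivmath0203120v7.tex`, l.626–758). [key `Burnol2004b`]
* W. Rudin, *Real and Complex Analysis*, 3rd ed., Ch. 19 (Hardy spaces of a half-plane). [folklore]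
-/

noncomputable section

open MeasureTheory Complex Filter Set
open scoped Topology

namespace Literature.NumberTheory.LFunctions

namespace IsHardyRight

variable {F G φ : ℂ → ℂ}

/-- The holomorphy component of `IsHardyRight` ("a space of analytic functions in the right half-plane").
[cite: Burnol2004b, §4 Definition of ℍ² (arXiv:math/0203120v7 p. 7–8, TeX l.626–631 and l.702–706)] -/
theorem differentiableOn (h : IsHardyRight F) : DifferentiableOn ℂ F {s | 1 / 2 < s.re} := h.1

/-- Points of a vertical line `Re s = σ > 1/2` lie in the half-plane `Re s > 1/2` (the vertical lines
of the definition of `ℍ²`). [cite: Burnol2004b, §4 Definition of ℍ² (arXiv:math/0203120v7 p. 7–8, TeX l.626–631 and l.702–706)] -/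
theorem re_line {σ : ℝ} (hσ : 1 / 2 < σ) (τ : ℝ) : 1 / 2 < ((σ : ℂ) + τ * I).re := by
  have : ((σ : ℂ) + τ * I).re = σ := by simp
  rw [this]; exact hσ

/-- A function holomorphic on `Re s > 1/2` is continuous along every vertical line `Re s = σ > 1/2`
(so its line restrictions are measurable, as the definition of `ℍ²` requires).
[cite: Burnol2004b, §4 Definition of ℍ² (arXiv:math/0203120v7 p. 7–8, TeX l.626–631 and l.702–706)] -/
theorem continuous_line (hF : DifferentiableOn ℂ F {s | 1 / 2 < s.re}) {σ : ℝ} (hσ : 1 / 2 < σ) :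
    Continuous (fun τ : ℝ ↦ F (σ + τ * I)) := by
  have hline : Continuous (fun τ : ℝ ↦ (σ : ℂ) + τ * I) := by fun_prop
  exact hF.continuousOn.comp_continuous hline (fun τ ↦ re_line hσ τ)

/-- `ℍ²`-membership only depends on the values on the open half-plane `Re s > 1/2` (the analytic
picture). [cite: Burnol2004b, §4 Definition of ℍ² (arXiv:math/0203120v7 p. 7–8, TeX l.626–631 and l.702–706)] -/
theorem congr (h : IsHardyRight F) (hG : ∀ s : ℂ, 1 / 2 < s.re → G s = F s) : IsHardyRight G := by
  refine ⟨h.1.congr (fun s hs ↦ hG s hs), ?_⟩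
  obtain ⟨C, hC⟩ := h.2
  refine ⟨C, fun σ hσ ↦ ?_⟩
  have heq : (fun τ : ℝ ↦ G (σ + τ * I)) = fun τ : ℝ ↦ F (σ + τ * I) := by
    funext τ; exact hG _ (re_line hσ τ)
  have heq2 : (fun τ : ℝ ↦ ‖G (σ + τ * I)‖ ^ 2) = fun τ : ℝ ↦ ‖F (σ + τ * I)‖ ^ 2 := by
    funext τ; rw [hG _ (re_line hσ τ)]
  refine ⟨?_, ?_⟩
  · rw [heq]; exact (hC σ hσ).1
  · rw [heq2]; exact (hC σ hσ).2

/-- The uniform bound of the `L²` norms on vertical lines in the definition of `ℍ²` is nonnegative.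
[cite: Burnol2004b, §4 Definition of ℍ² (arXiv:math/0203120v7 p. 7–8, TeX l.626–631 and l.702–706)] -/
theorem bound_nonneg {C : ℝ}
    (hC : ∀ σ : ℝ, 1 / 2 < σ →
      MemLp (fun τ : ℝ ↦ F (σ + τ * I)) 2 volume ∧ ∫ τ : ℝ, ‖F (σ + τ * I)‖ ^ 2 ≤ C) : 0 ≤ C :=
  le_trans (integral_nonneg (fun τ ↦ by positivity)) (hC 1 (by norm_num)).2

/-- `0 ∈ ℍ²` (`ℍ²` is a vector space). [cite: Burnol2004b, §4 Definition of ℍ² (arXiv:math/0203120v7 p. 7–8, TeX l.626–631 and l.702–706)]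
[cite: Rudin1987, Ch. 19, Definition 19.1 (Hardy space of a half-plane)] -/
theorem zero : IsHardyRight (fun _ ↦ 0) := by
  refine ⟨differentiableOn_const 0, 0, fun σ _ ↦ ⟨?_, by simp⟩⟩
  exact MemLp.zero'

/-- **Bounded holomorphic multipliers preserve `ℍ²`.** If `F ∈ ℍ²` and `φ` is holomorphic on
`Re s > 1/2` with `‖φ(s)‖ ≤ C` there, then `φ·F ∈ ℍ²` (the mechanism of "`s^l/(s−ρ)^l` is bounded, so
going back to the definition of `ℍ²` … we obtain the desired conclusion", Prop. 4.2, and of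
"`1/|s| = O(1)` on `Re(s) ≥ 1/2`", Lemma 4.4).
[cite: Burnol2004b, Prop. 4.2 and Lemma 4.4, proofs (arXiv:math/0203120v7 p. 8, TeX l.702–706, l.752–754)] -/
theorem mul_of_bounded (h : IsHardyRight F) (hφ : DifferentiableOn ℂ φ {s | 1 / 2 < s.re}) {C : ℝ}
    (hC : ∀ s : ℂ, 1 / 2 < s.re → ‖φ s‖ ≤ C) : IsHardyRight (fun s ↦ φ s * F s) := by
  refine ⟨hφ.mul h.1, ?_⟩
  obtain ⟨B, hB⟩ := h.2
  refine ⟨C ^ 2 * B, fun σ hσ ↦ ?_⟩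
  obtain ⟨hmem, hint⟩ := hB σ hσ
  have hmeas : AEStronglyMeasurable (fun τ : ℝ ↦ φ (σ + τ * I) * F (σ + τ * I)) volume :=
    ((continuous_line hφ hσ).mul (continuous_line h.1 hσ)).aestronglyMeasurable
  have hle : ∀ τ : ℝ, ‖φ (σ + τ * I) * F (σ + τ * I)‖ ≤ C * ‖F (σ + τ * I)‖ := fun τ ↦ by
    rw [norm_mul]; exact mul_le_mul_of_nonneg_right (hC _ (re_line hσ τ)) (norm_nonneg _)
  have hmem' : MemLp (fun τ : ℝ ↦ φ (σ + τ * I) * F (σ + τ * I)) 2 volume :=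
    MemLp.of_le_mul hmem hmeas (Eventually.of_forall hle)
  refine ⟨hmem', ?_⟩
  have hi1 : Integrable (fun τ : ℝ ↦ ‖F (σ + τ * I)‖ ^ 2) :=
    (memLp_two_iff_integrable_sq_norm hmem.1).1 hmem
  have hi2 : Integrable (fun τ : ℝ ↦ ‖φ (σ + τ * I) * F (σ + τ * I)‖ ^ 2) :=
    (memLp_two_iff_integrable_sq_norm hmeas).1 hmem'
  calc ∫ τ : ℝ, ‖φ (σ + τ * I) * F (σ + τ * I)‖ ^ 2
      ≤ ∫ τ : ℝ, C ^ 2 * ‖F (σ + τ * I)‖ ^ 2 := by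
        refine integral_mono hi2 (hi1.const_mul _) (fun τ ↦ ?_)
        have h0 : 0 ≤ ‖φ (σ + τ * I) * F (σ + τ * I)‖ := norm_nonneg _
        calc ‖φ (σ + τ * I) * F (σ + τ * I)‖ ^ 2 ≤ (C * ‖F (σ + τ * I)‖) ^ 2 :=
              pow_le_pow_left₀ h0 (hle τ) 2
          _ = C ^ 2 * ‖F (σ + τ * I)‖ ^ 2 := by ring
    _ = C ^ 2 * ∫ τ : ℝ, ‖F (σ + τ * I)‖ ^ 2 := integral_const_mul _ _
    _ ≤ C ^ 2 * B := by gcongr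

/-- Scalar multiples: `F ∈ ℍ² ⇒ c·F ∈ ℍ²` (`ℍ²` is a vector space). [cite: Burnol2004b, §4 Definition of ℍ² (arXiv:math/0203120v7 p. 7–8, TeX l.626–631 and l.702–706)]
[cite: Rudin1987, Ch. 19, Definition 19.1 (Hardy space of a half-plane)] -/
theorem const_mul (h : IsHardyRight F) (c : ℂ) : IsHardyRight (fun s ↦ c * F s) :=
  h.mul_of_bounded (differentiableOn_const c) (C := ‖c‖) (fun _ _ ↦ le_rfl)

/-- `F ∈ ℍ² ⇒ −F ∈ ℍ²` (`ℍ²` is a vector space). [cite: Burnol2004b, §4 Definition of ℍ² (arXiv:math/0203120v7 p. 7–8, TeX l.626–631 and l.702–706)]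
[cite: Rudin1987, Ch. 19, Definition 19.1 (Hardy space of a half-plane)] -/
theorem neg (h : IsHardyRight F) : IsHardyRight (fun s ↦ -F s) := by
  have := h.const_mul (-1)
  simpa using this

/-- Sums: `F, G ∈ ℍ² ⇒ F + G ∈ ℍ²` (`ℍ²` is a vector space; `‖a+b‖² ≤ 2‖a‖² + 2‖b‖²`). [cite: Burnol2004b, §4 Definition of ℍ² (arXiv:math/0203120v7 p. 7–8, TeX l.626–631 and l.702–706)]
[cite: Rudin1987, Ch. 19, Definition 19.1 (Hardy space of a half-plane)] -/
theorem add (hF : IsHardyRight F) (hG : IsHardyRight G) : IsHardyRight (fun s ↦ F s + G s) := by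
  refine ⟨hF.1.add hG.1, ?_⟩
  obtain ⟨B₁, hB₁⟩ := hF.2
  obtain ⟨B₂, hB₂⟩ := hG.2
  refine ⟨2 * B₁ + 2 * B₂, fun σ hσ ↦ ?_⟩
  obtain ⟨hm₁, hi₁⟩ := hB₁ σ hσ
  obtain ⟨hm₂, hi₂⟩ := hB₂ σ hσ
  have hmem : MemLp (fun τ : ℝ ↦ F (σ + τ * I) + G (σ + τ * I)) 2 volume := hm₁.add hm₂
  refine ⟨hmem, ?_⟩
  have hI₁ : Integrable (fun τ : ℝ ↦ ‖F (σ + τ * I)‖ ^ 2) :=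
    (memLp_two_iff_integrable_sq_norm hm₁.1).1 hm₁
  have hI₂ : Integrable (fun τ : ℝ ↦ ‖G (σ + τ * I)‖ ^ 2) :=
    (memLp_two_iff_integrable_sq_norm hm₂.1).1 hm₂
  have hI : Integrable (fun τ : ℝ ↦ ‖F (σ + τ * I) + G (σ + τ * I)‖ ^ 2) :=
    (memLp_two_iff_integrable_sq_norm hmem.1).1 hmem
  calc ∫ τ : ℝ, ‖F (σ + τ * I) + G (σ + τ * I)‖ ^ 2
      ≤ ∫ τ : ℝ, (2 * ‖F (σ + τ * I)‖ ^ 2 + 2 * ‖G (σ + τ * I)‖ ^ 2) := by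
        refine integral_mono hI ((hI₁.const_mul 2).add (hI₂.const_mul 2)) (fun τ ↦ ?_)
        have h1 := norm_add_le (F (σ + τ * I)) (G (σ + τ * I))
        have h2 : 0 ≤ ‖F (σ + τ * I) + G (σ + τ * I)‖ := norm_nonneg _
        nlinarith [h1, h2, norm_nonneg (F (σ + τ * I)), norm_nonneg (G (σ + τ * I)),
          sq_nonneg (‖F (σ + τ * I)‖ - ‖G (σ + τ * I)‖)]
    _ = 2 * (∫ τ : ℝ, ‖F (σ + τ * I)‖ ^ 2) + 2 * (∫ τ : ℝ, ‖G (σ + τ * I)‖ ^ 2) := by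
        rw [integral_add (hI₁.const_mul 2) (hI₂.const_mul 2), integral_const_mul,
          integral_const_mul]
    _ ≤ 2 * B₁ + 2 * B₂ := by gcongr

/-- Differences: `F, G ∈ ℍ² ⇒ F − G ∈ ℍ²` (`ℍ²` is a vector space). [cite: Burnol2004b, §4 Definition of ℍ² (arXiv:math/0203120v7 p. 7–8, TeX l.626–631 and l.702–706)]
[cite: Rudin1987, Ch. 19, Definition 19.1 (Hardy space of a half-plane)] -/
theorem sub (hF : IsHardyRight F) (hG : IsHardyRight G) : IsHardyRight (fun s ↦ F s - G s) := by
  have := hF.add hG.neg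
  simpa [sub_eq_add_neg] using this

/-- **`F ∈ ℍ² ⇒ F(s)/s ∈ ℍ²`** ("simply from `1/|s| = O(1)` on `Re(s) ≥ 1/2`": `‖1/s‖ ≤ 2` there) — the
first step of Lemma 4.4. [cite: Burnol2004b, Lemma 4.4, proof (arXiv:math/0203120v7 p. 8, TeX l.752–754)] -/
theorem div_id (h : IsHardyRight F) : IsHardyRight (fun s ↦ F s / s) := by
  have hne : ∀ s ∈ {s : ℂ | 1 / 2 < s.re}, s ≠ 0 := by
    intro s hs h0
    simp only [Set.mem_setOf_eq, h0, Complex.zero_re] at hs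
    linarith
  have hinv : DifferentiableOn ℂ (fun s : ℂ ↦ s⁻¹) {s | 1 / 2 < s.re} :=
    differentiableOn_id.inv hne
  have hb : ∀ s : ℂ, 1 / 2 < s.re → ‖s⁻¹‖ ≤ 2 := by
    intro s hs
    have h1 : 1 / 2 < ‖s‖ := lt_of_lt_of_le hs (le_trans (le_abs_self _) (Complex.abs_re_le_norm s))
    rw [norm_inv]
    calc ‖s‖⁻¹ ≤ (1 / 2)⁻¹ := by
          exact inv_anti₀ (by norm_num) h1.le
      _ = 2 := by norm_num
  have hmul := h.mul_of_bounded hinv hb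
  refine hmul.congr (fun s _ ↦ ?_)
  simp [div_eq_mul_inv, mul_comm]

/-- **Modification off a rectangle.** Let `F ∈ ℍ²`, `G` holomorphic on `Re s > 1/2`, bounded by
`M` on the part of the rectangle `σ₁ ≤ Re s ≤ σ₂`, `|Im s| ≤ R` lying in the half-plane, and suppose
`‖G(s)‖ ≤ C ‖F(s)‖` for all `s` of the half-plane outside that rectangle (`C, R, M ≥ 0`; `σ₁ ≤ 1/2` is
allowed — a neighbourhood of a point of the critical line). Then `G ∈ ℍ²`: on the lines meeting the
rectangle the `L²` norm over `|τ| ≤ R` is at most `2R·M²`, and elsewhere `‖G‖² ≤ C²‖F‖²`. This is the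
step "if we exclude a neighborhood of `ρ` then `s^l/(s−ρ)^l` is bounded, so going back to the
definition of `ℍ²` as a space of analytic functions in the right half-plane with a uniform bound of
their `L²` norms on vertical lines we obtain the desired conclusion" of Prop. 4.2 (and of Prop. 4.3).
[cite: Burnol2004b, Prop. 4.2, proof (arXiv:math/0203120v7 p. 8, TeX l.702–706)] -/
theorem of_le_off_rect' (h : IsHardyRight F) (hG : DifferentiableOn ℂ G {s | 1 / 2 < s.re})
    {σ₁ σ₂ R C M : ℝ} (hR : 0 ≤ R) (hC : 0 ≤ C) (hM0 : 0 ≤ M)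
    (hMK : ∀ s : ℂ, 1 / 2 < s.re → σ₁ ≤ s.re → s.re ≤ σ₂ → |s.im| ≤ R → ‖G s‖ ≤ M)
    (hb : ∀ s : ℂ, 1 / 2 < s.re → (s.re < σ₁ ∨ σ₂ < s.re ∨ R < |s.im|) → ‖G s‖ ≤ C * ‖F s‖) :
    IsHardyRight G := by
  refine ⟨hG, ?_⟩
  obtain ⟨B, hB⟩ := h.2
  have hB0 : 0 ≤ B := bound_nonneg hB
  refine ⟨2 * C ^ 2 * B + 4 * M ^ 2 * R, fun σ hσ ↦ ?_⟩
  obtain ⟨hmem, hint⟩ := hB σ hσ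
  have hcont : Continuous (fun τ : ℝ ↦ G (σ + τ * I)) := continuous_line hG hσ
  have hmeas : AEStronglyMeasurable (fun τ : ℝ ↦ G (σ + τ * I)) volume := hcont.aestronglyMeasurable
  have hI₁ : Integrable (fun τ : ℝ ↦ ‖F (σ + τ * I)‖ ^ 2) :=
    (memLp_two_iff_integrable_sq_norm hmem.1).1 hmem
  -- the dominating function `d = C‖F‖ + M·𝟙_{[-R, R]}`
  set d : ℝ → ℝ := fun τ ↦ C * ‖F (σ + τ * I)‖ + (Set.Icc (-R) R).indicator (fun _ ↦ M) τ with hd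
  have hind_nonneg : ∀ τ : ℝ, 0 ≤ (Set.Icc (-R) R).indicator (fun _ ↦ M) τ := fun τ ↦ by
    by_cases hτ : τ ∈ Set.Icc (-R) R
    · rw [Set.indicator_of_mem hτ]; exact hM0
    · rw [Set.indicator_of_notMem hτ]
  have hind_sq : ∀ τ : ℝ, ((Set.Icc (-R) R).indicator (fun _ ↦ M) τ) ^ 2 =
      (Set.Icc (-R) R).indicator (fun _ ↦ M ^ 2) τ := fun τ ↦ by
    by_cases hτ : τ ∈ Set.Icc (-R) R
    · rw [Set.indicator_of_mem hτ, Set.indicator_of_mem hτ]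
    · rw [Set.indicator_of_notMem hτ, Set.indicator_of_notMem hτ]; ring
  have hd0 : ∀ τ : ℝ, 0 ≤ d τ := fun τ ↦ by
    have := hind_nonneg τ; simp only [hd]; positivity
  -- pointwise domination `‖G(σ+iτ)‖ ≤ d τ`
  have hdom : ∀ τ : ℝ, ‖G (σ + τ * I)‖ ≤ d τ := by
    intro τ
    by_cases hout : (((σ : ℂ) + τ * I).re < σ₁ ∨ σ₂ < ((σ : ℂ) + τ * I).re ∨ R < |((σ : ℂ) + τ * I).im|)
    · have h1 := hb _ (re_line hσ τ) hout
      have h2 := hind_nonneg τ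
      simp only [hd]; linarith
    · -- inside the rectangle
      push Not at hout
      obtain ⟨h1, h2, h3⟩ := hout
      have h4 := hMK _ (re_line hσ τ) h1 h2 h3
      have hτ : τ ∈ Set.Icc (-R) R := by
        have : ((σ : ℂ) + τ * I).im = τ := by simp
        rw [this] at h3
        exact abs_le.1 h3
      have h5 : (Set.Icc (-R) R).indicator (fun _ ↦ M) τ = M := Set.indicator_of_mem hτ _
      have h6 : 0 ≤ C * ‖F (σ + τ * I)‖ := by positivity
      simp only [hd, h5]; linarith
  -- `d ∈ L²`
  have hind_mem : MemLp (fun τ : ℝ ↦ (Set.Icc (-R) R).indicator (fun _ ↦ M) τ) 2 volume :=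
    memLp_indicator_const 2 measurableSet_Icc M (Or.inr (by
      rw [Real.volume_Icc]; exact ENNReal.ofReal_ne_top))
  have hdmem : MemLp d 2 volume := (hmem.norm.const_mul C).add hind_mem
  have hGmem : MemLp (fun τ : ℝ ↦ G (σ + τ * I)) 2 volume :=
    MemLp.of_le hdmem hmeas (Eventually.of_forall (fun τ ↦ by
      rw [Real.norm_of_nonneg (hd0 τ)]; exact hdom τ))
  refine ⟨hGmem, ?_⟩
  -- the integral bound
  have hIG : Integrable (fun τ : ℝ ↦ ‖G (σ + τ * I)‖ ^ 2) :=
    (memLp_two_iff_integrable_sq_norm hmeas).1 hGmem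
  have hIind : Integrable (fun τ : ℝ ↦ (Set.Icc (-R) R).indicator (fun _ ↦ M ^ 2) τ) :=
    (integrable_indicator_iff measurableSet_Icc).2
      ((integrableOn_const_iff).2 (Or.inr (by rw [Real.volume_Icc]; exact ENNReal.ofReal_lt_top)))
  have hIrhs : Integrable (fun τ : ℝ ↦ 2 * C ^ 2 * ‖F (σ + τ * I)‖ ^ 2 +
      2 * (Set.Icc (-R) R).indicator (fun _ ↦ M ^ 2) τ) :=
    (hI₁.const_mul _).add (hIind.const_mul _)
  calc ∫ τ : ℝ, ‖G (σ + τ * I)‖ ^ 2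
      ≤ ∫ τ : ℝ, (2 * C ^ 2 * ‖F (σ + τ * I)‖ ^ 2 +
          2 * (Set.Icc (-R) R).indicator (fun _ ↦ M ^ 2) τ) := by
        refine integral_mono hIG hIrhs (fun τ ↦ ?_)
        have h1 := hdom τ
        have h2 : 0 ≤ ‖G (σ + τ * I)‖ := norm_nonneg _
        have h3 : ‖G (σ + τ * I)‖ ^ 2 ≤ d τ ^ 2 := pow_le_pow_left₀ h2 h1 2
        have h4 : d τ ^ 2 ≤ 2 * (C * ‖F (σ + τ * I)‖) ^ 2 +
            2 * ((Set.Icc (-R) R).indicator (fun _ ↦ M) τ) ^ 2 := by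
          simp only [hd]
          nlinarith [sq_nonneg (C * ‖F (σ + τ * I)‖ - (Set.Icc (-R) R).indicator (fun _ ↦ M) τ)]
        rw [hind_sq] at h4
        calc ‖G (σ + τ * I)‖ ^ 2 ≤ d τ ^ 2 := h3
          _ ≤ _ := h4
          _ = _ := by ring
    _ = 2 * C ^ 2 * (∫ τ : ℝ, ‖F (σ + τ * I)‖ ^ 2) +
          2 * (∫ τ : ℝ, (Set.Icc (-R) R).indicator (fun _ ↦ M ^ 2) τ) := by
        rw [integral_add (hI₁.const_mul _) (hIind.const_mul _), integral_const_mul,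
          integral_const_mul]
    _ = 2 * C ^ 2 * (∫ τ : ℝ, ‖F (σ + τ * I)‖ ^ 2) + 2 * (M ^ 2 * (2 * R)) := by
        congr 2
        rw [integral_indicator_const _ measurableSet_Icc, Real.volume_real_Icc_of_le (by linarith),
          smul_eq_mul]
        ring
    _ ≤ 2 * C ^ 2 * B + 2 * (M ^ 2 * (2 * R)) := by gcongr
    _ = 2 * C ^ 2 * B + 4 * M ^ 2 * R := by ring

/-- **Modification off a compact rectangle of the open half-plane.** Let `F ∈ ℍ²`, `G` holomorphic on
`Re s > 1/2`, and suppose `‖G(s)‖ ≤ C ‖F(s)‖` for all `s` of the half-plane outside the compact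
rectangle `σ₁ ≤ Re s ≤ σ₂`, `|Im s| ≤ R` (`σ₁ > 1/2`, `C, R ≥ 0`). Then `G ∈ ℍ²` (the bound on the
rectangle is supplied by continuity; `of_le_off_rect'`).
[cite: Burnol2004b, Prop. 4.2, proof (arXiv:math/0203120v7 p. 8, TeX l.702–706)] -/
theorem of_le_off_rect (h : IsHardyRight F) (hG : DifferentiableOn ℂ G {s | 1 / 2 < s.re})
    {σ₁ σ₂ R C : ℝ} (hσ₁ : 1 / 2 < σ₁) (hR : 0 ≤ R) (hC : 0 ≤ C)
    (hb : ∀ s : ℂ, 1 / 2 < s.re → (s.re < σ₁ ∨ σ₂ < s.re ∨ R < |s.im|) → ‖G s‖ ≤ C * ‖F s‖) :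
    IsHardyRight G := by
  -- a bound `M` for `G` on the compact rectangle
  set K : Set ℂ := Set.Icc σ₁ σ₂ ×ℂ Set.Icc (-R) R with hK
  have hKc : IsCompact K := isCompact_Icc.reProdIm isCompact_Icc
  have hKsub : K ⊆ {s | 1 / 2 < s.re} := fun s hs ↦
    lt_of_lt_of_le hσ₁ (Complex.mem_reProdIm.1 hs).1.1
  obtain ⟨M₀, hM₀⟩ := hKc.exists_bound_of_continuousOn (hG.continuousOn.mono hKsub)
  refine h.of_le_off_rect' hG hR hC (le_max_right M₀ 0) (fun s _ h1 h2 h3 ↦ ?_) hb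
  exact (hM₀ s (Complex.mem_reProdIm.2 ⟨⟨h1, h2⟩, abs_le.1 h3⟩)).trans (le_max_left _ _)

end IsHardyRight

end Literature.NumberTheory.LFunctions

end
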